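import Literature.MathematicalPhysics.QuantumFieldTheory.Balaban1983to89.B10Eq38TorusDomains
import Literature.MathematicalPhysics.QuantumFieldTheory.Balaban1983to89.B14Eq213DetSet
import Literature.MathematicalPhysics.QuantumFieldTheory.Balaban1983to89.B10StarCount

/-!
# `Balaban1983to89.B10Eq71TorusOverlap` — [Balaban1985UV3] p. 273, after **(71)** «We get these small factors for all plaquettes in
# all large fields set P»: THE OVERLAP OF THE REGIONS `Δ′(p′)` ON THE TORUS CARRIER OF RECORD, with the cross-scale disjointness
# DERIVED from the p. 268 rule WITH BODY (`B10Eq38TorusDomains.omegaSeq`) — `c₁ = ¼` with no reading hypothesis left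

T. Bałaban, *Ultraviolet stability of three-dimensional lattice pure gauge field theories*, Commun. Math. Phys. **102**, 255–275
(1985) [Balaban1985UV3] (cell paper B10; held `paper:balaban1985-cmp102-uv-stability-3d`, journal page = PDF page + 254; p. 273 =
[PDF 19], p. 268 = [PDF 14], p. 266 = [PDF 12] re-read 2026-08-23 on the text layers `p0019.txt`, `p0014.txt`).  «…» = verbatim.

HONEST FRAMING (mega-formalization `lit-balaban`, verbatim): statement-level skeleton of published theorems with citation tags; proofs
where landed; nothing here is a claim about the Yang–Mills mass gap.

## The printed text

p. 273: «Thus the part of the action 1/g_k²A^η(U_k) localized to the sum of four j-blocks Δ′ connected with the plaquette p′ can be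
bounded from below by 1/4p²(g_j), and the corresponding part of the exponential gives the small factor exp(−1/4p²(g_j)). We get these
small factors for all plaquettes in all large fields set P.»  with (70) «where Δ′ = B^j(x₀) ∪ B^j(y₀) ∪ B^j(z₀) ∪ B^j(w₀)» for
«p′ = ⟨x₀, y₀, z₀, w₀⟩» and «Let us take a plaquette p′ ⊂ Λ_j».  p. 268: «We define the set Ω_{k+1}^{(k)} as a union of big blocks
of the lattice T₁^{(k)}, with distances to P ∪ Ω_k^{(k)c} greater than R(g_k)M₁»; «We change the definition of Λ_k, taking Λ_k =
Ω_k^{(k)}∖Ω_{k+1}^{(k)}, and we define Λ_{k+1} = Ω_{k+1}^{(k+1)}, hence Ω_{k+1}^{(k)} = B(Λ_{k+1})».  p. 266 (38): «Thus we obtain a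
sequence of domains Ω₁ ⊃ Ω₂ ⊃ ⋯ ⊃ Ω_k, Ω_j ⊂ T_η»; p. 267: «We introduce the decomposition of unity (7) for the field V on the domain
Λ_k, with ε₁ = g_kp(g_k)».

## Why this file exists (unit `lit-balaban-r07`, reader/typer and fold owner of B10; gen 55; rows B10.Eq70 / B10.Eq71, knit with B10.Eq38–Eq40)

`B10Eq71AllPlaquettes` (this unit, gen 55) made the unprinted overlap point behind «for all plaquettes in all large fields set P» (cell
GAPS G-B10-10(a)) a kernel theorem on the `ℤ^d` model geometry of `B10Eq70Squaring`: each fine plaquette lies in `≤ 4` regions `Δ′(p′)`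
of one scale, and the regions of DIFFERENT scales are disjoint under two inclusions `hout`/`hin` — the READING of (38) and the p. 268
rule — which there remain hypotheses (v1.1 reduces them to the cell's typed `B10LargeField.Rule268` plus two adjacency readings).  THIS
FILE DOES THE SAME ON THE TORUS CARRIER OF RECORD `Setup.Site P 0` (= `T_η`), where the p. 268 rule HAS A BODY (`B10Eq38TorusDomains`,
rows B10.Eq38–Eq40: `omegaSeq`, `plaqRule`, `cornerPts`, `plaqsIn`), and DISCHARGES BOTH INCLUSIONS:

* §1 blocks and centres: the `j`-block of a fine site `x` is `blockIter j x ∈ T^{(j)}` (pub-balaban's `B14.Eq22Determines.blockIter`),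
  the fine centre of a level-`j` site is `toFine j c` (`B10Eq38TorusDomains.toFine` = `B15DeterminingSets.embIter`); their `L^j`-cube
  labels (`B3Ineq314Cubes.cubeIdx`) agree exactly when `blockIter j x = c` (`blockIter_eq_iff_cubeIdx`, from the label arithmetic
  `val_blockIter` / `val_embIter_div` of `B14.Eq213DetSet`; standing range `j ≤ m + K`);
* §2 **`Δ′(p′)` WITH BODY ON THE TORUS**: `deltaT j p′` = the fine plaquettes `q ∈ Plaq P 0` parallel to `p′` whose `j`-block is one
  of the four corners of `p′` — print's «Δ′ = B^j(x₀) ∪ B^j(y₀) ∪ B^j(z₀) ∪ B^j(w₀)» literally (`cornersJ`, `mem_deltaT_iff`);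
* §3 **one scale**: each fine plaquette lies in `deltaT j p′` for at most FOUR level-`j` plaquettes `p′` (`card_filter_mem_deltaT_le`:
  `p′.src ∈ {a, a − e_μ, a − e_ν, a − e_μ − e_ν}`, `a` = the `j`-block of the fine corner);
* §4 **across scales, NO HYPOTHESIS OF READING**: for the domains `Ω = omegaSeq P M₁ R Ω₀ (cornerPts ∘ S)` generated by the rule from the
  large-field plaquette sets `S j ⊆ plaqsIn j (Ω j)` («(7) for the field V on the domain»), with `R(g_j)M₁ ≥ 0`, `L ∣ M₁` (p. 268
  «Ω_{k+1}^{(k)} = B(Λ_{k+1})»: the big blocks of `T₁^{(k)}` are unions of `L`-blocks) and the standing range: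
  **`src_not_mem_omega_succ`** — a fine plaquette of `Δ′_j(p′)`, `p′ ∈ S j`, has its corner OUTSIDE `Ω_{j+1}` (the rule keeps `Ω_{j+1}`, a
  union of `M₁L^j`-blocks hence of `L^j`-blocks, at distance `> R(g_j)M₁ ≥ 0` from the corner points of `P_j`: `sep_plaqRule_of_mem`,
  `isBlockUnion_omegaSeq_succ`); **`src_mem_omega_of_lt`** — a fine plaquette of `Δ′_{j′}(p″)`, `p″ ∈ S j′`, `j < j′`, has its corner INSIDE
  `Ω_{j+1}` (`Ω_{j′}` is a union of `L^{j′}`-blocks containing the corners of `p″`, and `Ω_{j′} ⊆ Ω_{j+1}` by (38) `omegaSeq_antitone`);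
  hence **`card_filter_levels_le`**: over ALL scales a fine plaquette lies in at most four regions;
* §5 **(71) FOR ALL LARGE-FIELD PLAQUETTES OF ALL SCALES SIMULTANEOUSLY ON THE TORUS, `c₁ = ¼`**: from per-plaquette lower bounds
  `w(j, p′) ≤ c·Σ_{q∈Δ′_j(p′)} act(q)` (print: `w = ¼p²(g_j)`, `c = (1/g_k²)η⁻¹`, (71)) and `act ≥ 0` on a finite set `Y` of fine plaquettes
  containing the regions: **`¼·Σ_{j∈J} Σ_{p′∈S′ j} w(j, p′) ≤ c·Σ_{q∈Y} act(q)`** (`quarter_sum_le_of_local71_torus`) — the inequality of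
  `B10LargeFieldSum.SmallFactorsAll` with the absolute `c₁ = ¼`, on the carrier of record.

DICTIONARY print ↦ Lean: `T_η` ↦ `Site P 0`, fine plaquettes ↦ `Plaq P 0`; `T^{(j)}` ↦ `Site P j`, level-`j` plaquettes `p′` ↦ `Plaq P j`;
`B^j(x)` (the `j`-block of fine sites under `x ∈ T^{(j)}`) ↦ `{y : blockIter j y = x}`; `Δ′(p′)` ↦ `deltaT j p′`; `Ω_j` ↦
`omegaSeq P M₁ R Ω₀ (fun i => cornerPts i (S i)) j`; `P_j` ↦ `S j : Finset (Plaq P j)`, its point set `cornerPts j (S j)`; «p′ ⊂ Λ_j»,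
«(7) … on the domain» ↦ `S j ⊆ plaqsIn j (Ω j)`; `R(g_j)M₁` ↦ `R j * M₁`.

HONEST SCOPE. (i) Geometry only: the per-plaquette (71) on the torus is NOT derived here (it is kernel on the `ℤ^d` model geometry —
`B10Eq70Squaring.smallFactor_of_largeField`, `B10Eq71Concrete` —; a torus transport of (69)–(71) is not attempted) and enters §5 as the
hypothesis `h71`; the action density `act ≥ 0` is abstract.  (ii) `Δ′(p′)` collects the fine plaquettes PARALLEL to `p′` with lower-left
corner in the four corner blocks (the reading of `B10Eq70Squaring`, for which (70) line 2 is proved); (71) holds a fortiori for larger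
plaquette sets.  (iii) `L ∣ M₁` and the standing range `j ≤ m + K` are hypotheses (print, p. 257: «a union of big blocks, i.e. blocks
of the size M₁»; the big blocks of `T₁^{(k)}` are unions of `L`-blocks by p. 268 «Ω_{k+1}^{(k)} = B(Λ_{k+1})»).  (iv) No instantiation of `B10LargeFieldSum.HistModel` from the true
(41) is attempted (cell GAPS G-B10-10 «what would discharge them»).  (v) Nothing of [Balaban1985UV3] beyond the quoted sentences is asserted;
`B10Eq38TorusDomains`, `B14.Eq213DetSet`, `B10StarCount` (`unshift_shift`) are used BY NAME, byte-identical; `B10Eq71AllPlaquettes` (the `ℤ^d` twin) is NOT imported — the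
summation step is re-proved here in three lines (`Finset.sum_comm'`), so this file does not depend on it.

WHAT THIS FILE PROVES (kernel, no `sorry`, no named facts, no structures; definitions with bodies `cornersJ`, `deltaT`; theorems otherwise;
axioms standard).  Value = rows B10.Eq70/Eq71 member “(71) for all large-field plaquettes simultaneously” ON THE CARRIER OF RECORD with the cross-scale
inclusions discharged by the rule instance of rows B10.Eq38–Eq40; NOT summit progress.
-/

noncomputable section

open scoped BigOperators

namespace Literature.MathematicalPhysics.QuantumFieldTheory.Balaban1983to89.B10Eq71TorusOverlap

open Literature.MathematicalPhysics.QuantumFieldTheory.Balaban1983to89.B3Ineq314Cubes (cubeIdx)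
open Literature.MathematicalPhysics.QuantumFieldTheory.Balaban1983to89.B10Eq38TorusDomains (toFine cornerSet cornerPts
  plaqRule plaqsIn omegaSeq IsBlockUnion tdist_self cornerSet_subset_cornerPts mem_plaqsIn_iff omegaSeq_succ_eq_plaqRule
  sep_plaqRule_of_mem isBlockUnion_omegaSeq_succ omegaSeq_antitone)
open Literature.MathematicalPhysics.QuantumFieldTheory.Balaban1983to89.B14.Eq22Determines (blockIter blockIter_zero
  blockIter_succ)

variable {P : Params}

/-! ## §1 Blocks and centres: `blockIter`, `toFine` and their `L^j`-cube labels -/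

section Blocks

/-- `B10Eq38TorusDomains.toFine` (the inclusion `T^{(j)} ⊂ T_η` by iterated centres) IS pub-balaban's `B15DeterminingSets.embIter` (same
recursion). (bookkeeping of [Balaban1987RG1] (0.1), no content of the series) [cite: Balaban1987RG1, (0.1) p.251] -/
theorem toFine_eq_embIter : ∀ (j : ℕ) (y : Site P j), toFine j y = B15DeterminingSets.embIter j y
  | 0, _ => rfl
  | j + 1, y => toFine_eq_embIter j (emb y)

/-- The `L^j`-cube label of the centre of a level-`j` site is the site's own label: `⌊(toFine j c)_μ / L^j⌋ = c_μ` (standing range).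
(bookkeeping of [Balaban1987RG1] (0.1), no content of the series) [cite: Balaban1987RG1, (0.1) p.251] -/
theorem cubeIdx_toFine {j : ℕ} (hj : j ≤ P.m + P.K) (c : Site P j) :
    cubeIdx (P.L ^ j) (toFine j c) = fun μ => (c μ).val := by
  funext μ
  show ((toFine j c) μ).val / P.L ^ j = (c μ).val
  rw [toFine_eq_embIter]
  exact B14.Eq213DetSet.val_embIter_div hj c μ

/-- The `L^j`-cube label of a fine site is the label of its `j`-block: `⌊x_μ / L^j⌋ = (blockIter j x)_μ` (standing range).
(bookkeeping of [Balaban1987RG1] (0.1), no content of the series) [cite: Balaban1987RG1, (0.1) p.252] -/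
theorem cubeIdx_eq_blockIter {j : ℕ} (hj : j ≤ P.m + P.K) (x : Site P 0) :
    cubeIdx (P.L ^ j) x = fun μ => ((blockIter j x) μ).val := by
  funext μ
  show (x μ).val / P.L ^ j = ((blockIter j x) μ).val
  rw [B14.Eq213DetSet.val_blockIter hj x μ]

/-- **A fine site lies in the `j`-block `B^j(c)` iff its `L^j`-cube is the cube of the centre of `c`** (standing range): `blockIter j x = c
⟺ cubeIdx L^j x = cubeIdx L^j (toFine j c)`. (bookkeeping of [Balaban1987RG1] (0.1)/(0.3), no content of the series)
[cite: Balaban1987RG1, (0.1) p.252] -/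
theorem blockIter_eq_iff_cubeIdx {j : ℕ} (hj : j ≤ P.m + P.K) (x : Site P 0) (c : Site P j) :
    blockIter j x = c ↔ cubeIdx (P.L ^ j) x = cubeIdx (P.L ^ j) (toFine j c) := by
  rw [cubeIdx_eq_blockIter hj, cubeIdx_toFine hj]
  constructor
  · rintro rfl; rfl
  · intro h
    funext μ
    exact ZMod.val_injective _ (congrFun h μ)

/-- A union of blocks of side `s` whose side divides: if `t ∣ s` then a union of `s`-blocks is a union of `t`-blocks (the block partitions
of the tori are nested, p. 268 «Ω_{k+1}^{(k)} = B(Λ_{k+1})»). [cite: Balaban1985UV3, p.268] -/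
theorem isBlockUnion_of_dvd {n s t : ℕ} (hts : t ∣ s) {Ω : Set (Site P n)} (h : IsBlockUnion s Ω) : IsBlockUnion t Ω := by
  obtain ⟨u, rfl⟩ := hts
  exact h.of_mul

end Blocks

/-! ## §2 `Δ′(p′)` with a body on the torus -/

section Delta

/-- The four corners `x₀, y₀ = x₀ + e_μ, w₀ = x₀ + e_ν, z₀ = x₀ + e_μ + e_ν` of a level-`j` plaquette `p′ = ⟨x₀, y₀, z₀, w₀⟩` as level-`j`
sites (their fine centres are `B10Eq38TorusDomains.cornerSet`). [cite: Balaban1985UV3, (70) p.273] -/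
def cornersJ {j : ℕ} (p : Plaq P j) : Finset (Site P j) :=
  {p.src, p.src.shift p.μ, p.src.shift p.ν, (p.src.shift p.μ).shift p.ν}

/-- The fine centre of a corner is a point of `cornerSet` (the point set `P` of `B10Eq38TorusDomains`). [cite: Balaban1985UV3, p.257; (70) p.273] -/
theorem toFine_mem_cornerSet {j : ℕ} {p : Plaq P j} {c : Site P j} (hc : c ∈ cornersJ p) : toFine j c ∈ cornerSet j p := by
  simp only [cornersJ, Finset.mem_insert, Finset.mem_singleton] at hc
  rcases hc with rfl | rfl | rfl | rfl <;> simp [cornerSet]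

/-- **`Δ′(p′)` WITH BODY ON THE TORUS** (p. 273 «where Δ′ = B^j(x₀) ∪ B^j(y₀) ∪ B^j(z₀) ∪ B^j(w₀)», «the sum of four j-blocks Δ′ connected
with the plaquette p′»): the fine plaquettes `q` of `T_η` parallel to `p′` whose lower-left corner lies in one of the four corner
`j`-blocks of `p′`, i.e. `blockIter j q.src ∈ {x₀, y₀, z₀, w₀}`. [cite: Balaban1985UV3, (70) p.273] -/
def deltaT (j : ℕ) (p : Plaq P j) : Finset (Plaq P 0) :=
  Finset.univ.filter fun q => q.μ = p.μ ∧ q.ν = p.ν ∧ blockIter j q.src ∈ cornersJ p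

/-- Membership in `Δ′(p′)`. [cite: Balaban1985UV3, (70) p.273] -/
theorem mem_deltaT_iff {j : ℕ} {p : Plaq P j} {q : Plaq P 0} :
    q ∈ deltaT j p ↔ q.μ = p.μ ∧ q.ν = p.ν ∧ blockIter j q.src ∈ cornersJ p := by
  simp [deltaT]

end Delta

/-! ## §3 One scale: each fine plaquette lies in at most four regions `Δ′(p′)` -/

section OneScale

/-- If `a` is a corner of the plaquette `p′` spanned by `e_μ, e_ν` then the lower-left corner of `p′` is one of `a, a − e_μ, a − e_ν,
a − e_ν − e_μ` — the four candidate positions, one per corner block (p. 273 «four j-blocks Δ′ connected with the plaquette p′»;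
torus bookkeeping `(x + e_μ) − e_μ = x` BY NAME from `B10StarCount.unshift_shift`).
[cite: Balaban1985UV3, (70) p.273] -/
theorem src_mem_of_mem_cornersJ {j : ℕ} {p : Plaq P j} {a : Site P j} (h : a ∈ cornersJ p) :
    p.src ∈ ({a, a.unshift p.μ, a.unshift p.ν, (a.unshift p.ν).unshift p.μ} : Finset (Site P j)) := by
  simp only [cornersJ, Finset.mem_insert, Finset.mem_singleton] at h
  simp only [Finset.mem_insert, Finset.mem_singleton]
  rcases h with h | h | h | h
  · exact Or.inl h.symm
  · exact Or.inr (Or.inl (by rw [h, B10StarCount.unshift_shift]))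
  · exact Or.inr (Or.inr (Or.inl (by rw [h, B10StarCount.unshift_shift])))
  · exact Or.inr (Or.inr (Or.inr (by rw [h, B10StarCount.unshift_shift, B10StarCount.unshift_shift])))

/-- Two plaquettes with the same lower-left corner and the same directions are equal. (elementary; the positively oriented plaquettes of
[Balaban1985Averaging] (5)) [cite: Balaban1985Averaging, (5) p.18] -/
theorem plaq_ext {j : ℕ} {p p' : Plaq P j} (hs : p.src = p'.src) (hμ : p.μ = p'.μ) (hν : p.ν = p'.ν) : p = p' := by
  cases p; cases p'
  simp only at hs hμ hν
  subst hs; subst hμ; subst hν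
  rfl

open scoped Classical in
/-- **THE OVERLAP COUNT ON THE TORUS (one scale):** a fine plaquette `q` lies in `Δ′(p′)` for AT MOST FOUR level-`j` plaquettes `p′` —
for every finite family `S`, `#{p′ ∈ S : q ∈ Δ′(p′)} ≤ 4`. [cite: Balaban1985UV3, (70)–(71) p.273] -/
theorem card_filter_mem_deltaT_le {j : ℕ} (S : Finset (Plaq P j)) (q : Plaq P 0) :
    (S.filter fun p => q ∈ deltaT j p).card ≤ 4 := by
  classical
  set a : Site P j := blockIter j q.src with ha
  set C : Finset (Site P j) := {a, a.unshift q.μ, a.unshift q.ν, (a.unshift q.ν).unshift q.μ} with hC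
  have hC4 : C.card ≤ 4 := by
    refine (Finset.card_insert_le _ _).trans ?_
    refine (Nat.succ_le_succ (Finset.card_insert_le _ _)).trans ?_
    refine (Nat.succ_le_succ (Nat.succ_le_succ (Finset.card_insert_le _ _))).trans ?_
    simp
  have h := Finset.card_le_card_of_injOn (fun p : Plaq P j => p.src) (s := S.filter fun p => q ∈ deltaT j p) (t := C) ?_ ?_
  · exact h.trans hC4
  · intro p hp
    have hq := (Finset.mem_filter.mp (Finset.mem_coe.mp hp)).2
    obtain ⟨hμ, hν, hc⟩ := mem_deltaT_iff.mp hq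
    have h1 := src_mem_of_mem_cornersJ hc
    rw [← hμ, ← hν] at h1
    exact Finset.mem_coe.mpr h1
  · intro p hp p' hp' heq
    have hq := (Finset.mem_filter.mp (Finset.mem_coe.mp hp)).2
    have hq' := (Finset.mem_filter.mp (Finset.mem_coe.mp hp')).2
    obtain ⟨hμ, hν, -⟩ := mem_deltaT_iff.mp hq
    obtain ⟨hμ', hν', -⟩ := mem_deltaT_iff.mp hq'
    exact plaq_ext heq (hμ.symm.trans hμ') (hν.symm.trans hν')

end OneScale

/-! ## §4 Across scales on the torus: the two inclusions are THEOREMS for the rule-generated domains -/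

section Scales

variable (M₁ : ℕ) (R : ℕ → ℝ) (Ω₀ : Set (Site P 0)) (S : (j : ℕ) → Finset (Plaq P j))

/-- The domains generated by the p. 268 rule from the large-field plaquette sets `P_j = S j` (`B10Eq38TorusDomains.omegaSeq` at the corner
point sets). [cite: Balaban1985UV3, (38) p.266; p.268] -/
abbrev Ω (j : ℕ) : Set (Site P 0) := omegaSeq P M₁ R Ω₀ (fun i => cornerPts i (S i)) j

/-- `Ω_{j+1}` is a union of `L^j`-blocks (it is a union of the big `M₁L^j`-blocks of `T₁^{(j)}`, `isBlockUnion_omegaSeq_succ`).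
[cite: Balaban1985UV3, (39) p.266; p.268] -/
theorem isBlockUnion_pow_omega_succ (j : ℕ) : IsBlockUnion (P.L ^ j) (Ω M₁ R Ω₀ S (j + 1)) := by
  have h := isBlockUnion_omegaSeq_succ M₁ R Ω₀ (fun i => cornerPts i (S i)) j
  rw [mul_comm] at h
  exact h.of_mul

/-- With `L ∣ M₁` (p. 268 «Ω_{k+1}^{(k)} = B(Λ_{k+1})»: the big blocks of `T₁^{(k)}` are unions of `L`-blocks) every `Ω_{j′}`, `j′ ≥ 1`, is a
union of `L^{j′}`-blocks. [cite: Balaban1985UV3, p.268] -/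
theorem isBlockUnion_pow_omega {j' : ℕ} (hj' : 1 ≤ j') (hdiv : P.L ∣ M₁) : IsBlockUnion (P.L ^ j') (Ω M₁ R Ω₀ S j') := by
  obtain ⟨i, rfl⟩ : ∃ i, j' = i + 1 := ⟨j' - 1, by omega⟩
  have h := isBlockUnion_omegaSeq_succ M₁ R Ω₀ (fun i => cornerPts i (S i)) i
  refine isBlockUnion_of_dvd ?_ h
  obtain ⟨u, rfl⟩ := hdiv
  exact ⟨u, by ring⟩

/-- **`hout` ON THE TORUS IS A THEOREM:** for a large-field plaquette `p′ ∈ P_j` (= `S j`) and a fine plaquette `q ∈ Δ′_j(p′)`, the corner of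
`q` lies OUTSIDE `Ω_{j+1}`.  Proof (p. 257 «in fact dist(P, Ω₁) > RM₁», at the passage `j → j+1`, = `sep_plaqRule_of_mem`): the
`L^j`-block of `q.src` is a corner block of `p′`, whose centre is a point of `P_j`; were `q.src ∈ Ω_{j+1}`, the whole block and hence that
corner point would lie in `Ω_{j+1}` (`Ω_{j+1}` is a union of `L^j`-blocks), at rule distance `> R(g_j)M₁ ≥ 0` from itself. Needs the standing
range `j ≤ m + K`. [cite: Balaban1985UV3, p.268; p.257; (71) p.273] -/
theorem src_not_mem_omega_succ {j : ℕ} (hj : j ≤ P.m + P.K) (hR : 0 ≤ R j * M₁) {p : Plaq P j} (hp : p ∈ S j)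
    {q : Plaq P 0} (hq : q ∈ deltaT j p) : q.src ∉ Ω M₁ R Ω₀ S (j + 1) := by
  intro hmem
  obtain ⟨-, -, hc⟩ := mem_deltaT_iff.mp hq
  set c : Site P j := blockIter j q.src with hcdef
  have hcube : cubeIdx (P.L ^ j) q.src = cubeIdx (P.L ^ j) (toFine j c) := (blockIter_eq_iff_cubeIdx hj q.src c).mp rfl
  have hcen : toFine j c ∈ Ω M₁ R Ω₀ S (j + 1) := ((isBlockUnion_pow_omega_succ M₁ R Ω₀ S j) hcube).mp hmem
  have hx : toFine j c ∈ cornerPts j (S j) := cornerSet_subset_cornerPts hp (toFine_mem_cornerSet hc)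
  have hy : toFine j c ∈ plaqRule P M₁ R j (Ω M₁ R Ω₀ S j) (S j) := by
    have e := omegaSeq_succ_eq_plaqRule M₁ R Ω₀ S j
    rw [← e]; exact hcen
  have hlt := sep_plaqRule_of_mem hx hy
  rw [tdist_self] at hlt
  simp at hlt
  linarith

/-- **`hin` ON THE TORUS IS A THEOREM:** for a large-field plaquette `p″ ∈ P_{j′}` made on the domain (`S j′ ⊆ plaqsIn j′ Ω_{j′}`: all four
corners in `Ω_{j′}`, p. 267 «(7) for the field V on the domain») and `j < j′`, every fine plaquette of `Δ′_{j′}(p″)` has its corner INSIDE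
`Ω_{j+1}`: its `L^{j′}`-block is a corner block of `p″`, contained in `Ω_{j′}` (a union of `L^{j′}`-blocks, `L ∣ M₁`), and `Ω_{j′} ⊆ Ω_{j+1}`
by (38) (`omegaSeq_antitone`, `R(g_i)M₁ ≥ 0`). Standing range `j′ ≤ m + K`. [cite: Balaban1985UV3, (38) p.266; p.267; p.268] -/
theorem src_mem_omega_of_lt (hR : ∀ i, 0 ≤ R i * M₁) (hdiv : P.L ∣ M₁) {j j' : ℕ} (hjj' : j < j')
    (hj' : j' ≤ P.m + P.K) (hS : S j' ⊆ plaqsIn j' (Ω M₁ R Ω₀ S j')) {p : Plaq P j'} (hp : p ∈ S j')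
    {q : Plaq P 0} (hq : q ∈ deltaT j' p) : q.src ∈ Ω M₁ R Ω₀ S (j + 1) := by
  obtain ⟨-, -, hc⟩ := mem_deltaT_iff.mp hq
  set c : Site P j' := blockIter j' q.src with hcdef
  have hcube : cubeIdx (P.L ^ j') q.src = cubeIdx (P.L ^ j') (toFine j' c) :=
    (blockIter_eq_iff_cubeIdx hj' q.src c).mp rfl
  have hcorner : toFine j' c ∈ Ω M₁ R Ω₀ S j' := (mem_plaqsIn_iff.mp (hS hp)) (toFine_mem_cornerSet hc)
  have hsrc : q.src ∈ Ω M₁ R Ω₀ S j' :=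
    ((isBlockUnion_pow_omega M₁ R Ω₀ S (by omega) hdiv) hcube).mpr hcorner
  exact omegaSeq_antitone hR Ω₀ (fun i => cornerPts i (S i)) (by omega : j + 1 ≤ j') hsrc

open scoped Classical in
/-- **ACROSS SCALES ON THE TORUS: every fine plaquette lies in the regions of at most ONE scale, hence in at most FOUR regions** —
for levels `j ∈ J` (all `≤ m + K`), sub-families `S′ j ⊆ S j` of the large-field plaquettes made on the domains (`S j ⊆ plaqsIn j Ω_j`),
`R(g_i)M₁ ≥ 0`, `L ∣ M₁`: `Σ_{j∈J} #{p′ ∈ S′ j : q ∈ Δ′_j(p′)} ≤ 4`.  The two inclusions of `B10Eq71AllPlaquettes.card_filter_scales_le` are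
the theorems `src_not_mem_omega_succ` / `src_mem_omega_of_lt`. [cite: Balaban1985UV3, (71) p.273, (38) p.266, p.268] -/
theorem card_filter_levels_le (hR : ∀ i, 0 ≤ R i * M₁) (hdiv : P.L ∣ M₁) (J : Finset ℕ) (hJ : ∀ j ∈ J, j ≤ P.m + P.K)
    (S' : (j : ℕ) → Finset (Plaq P j)) (hS' : ∀ j ∈ J, S' j ⊆ S j)
    (hS : ∀ j ∈ J, S j ⊆ plaqsIn j (Ω M₁ R Ω₀ S j)) (q : Plaq P 0) :
    ∑ j ∈ J, ((S' j).filter fun p => q ∈ deltaT j p).card ≤ 4 := by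
  classical
  -- either no region contains `q`, or all regions containing `q` have one level `j₀`
  by_cases hex : ∃ j₀ ∈ J, ∃ p₀ ∈ S' j₀, q ∈ deltaT j₀ p₀
  · obtain ⟨j₀, hj₀, p₀, hp₀, hq₀⟩ := hex
    have hzero : ∀ j ∈ J, j ≠ j₀ → ((S' j).filter fun p => q ∈ deltaT j p).card = 0 := by
      intro j hj hne
      rw [Finset.card_eq_zero, Finset.filter_eq_empty_iff]
      intro p hp hq
      rcases lt_or_gt_of_ne hne with hlt | hgt
      · -- j < j₀: q.src ∉ Ω_{j+1} (hout at j) but q.src ∈ Ω_{j+1} (hin from j₀)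
        exact src_not_mem_omega_succ M₁ R Ω₀ S (hJ j hj) (hR j) (hS' j hj hp) hq
          (src_mem_omega_of_lt M₁ R Ω₀ S hR hdiv hlt (hJ j₀ hj₀) (hS j₀ hj₀) (hS' j₀ hj₀ hp₀) hq₀)
      · exact src_not_mem_omega_succ M₁ R Ω₀ S (hJ j₀ hj₀) (hR j₀) (hS' j₀ hj₀ hp₀) hq₀
          (src_mem_omega_of_lt M₁ R Ω₀ S hR hdiv hgt (hJ j hj) (hS j hj) (hS' j hj hp) hq)
    rw [← Finset.add_sum_erase J _ hj₀]
    have hrest : ∑ j ∈ J.erase j₀, ((S' j).filter fun p => q ∈ deltaT j p).card = 0 :=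
      Finset.sum_eq_zero fun j hj => hzero j (Finset.mem_of_mem_erase hj) (Finset.ne_of_mem_erase hj)
    rw [hrest, add_zero]
    exact card_filter_mem_deltaT_le (S' j₀) q
  · have hzero : ∀ j ∈ J, ((S' j).filter fun p => q ∈ deltaT j p).card = 0 := by
      intro j hj
      rw [Finset.card_eq_zero, Finset.filter_eq_empty_iff]
      exact fun p hp hq => hex ⟨j, hj, p, hp, hq⟩
    rw [Finset.sum_eq_zero hzero]
    norm_num

end Scales

/-! ## §5 (71) for all large-field plaquettes of all scales simultaneously on the torus: `c₁ = ¼` -/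

section Assembly

variable (M₁ : ℕ) (R : ℕ → ℝ) (Ω₀ : Set (Site P 0)) (S : (j : ℕ) → Finset (Plaq P j))

/-- The localized sums against the one action, on the torus: `Σ_{j∈J} Σ_{p′∈S′ j} Σ_{q∈Δ′_j(p′)} G(q) ≤ 4·Σ_{q∈Y} G(q)` for `G ≥ 0` on a finite
set `Y` of fine plaquettes containing the regions (hypotheses of `card_filter_levels_le`). [cite: Balaban1985UV3, (71) p.273] -/
theorem sum_sum_deltaT_le (hR : ∀ i, 0 ≤ R i * M₁) (hdiv : P.L ∣ M₁) (J : Finset ℕ) (hJ : ∀ j ∈ J, j ≤ P.m + P.K)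
    (S' : (j : ℕ) → Finset (Plaq P j)) (hS' : ∀ j ∈ J, S' j ⊆ S j)
    (hS : ∀ j ∈ J, S j ⊆ plaqsIn j (Ω M₁ R Ω₀ S j)) (Y : Finset (Plaq P 0))
    (hY : ∀ j ∈ J, ∀ p ∈ S' j, deltaT j p ⊆ Y) (G : Plaq P 0 → ℝ) (hG : ∀ q ∈ Y, 0 ≤ G q) :
    ∑ j ∈ J, ∑ p ∈ S' j, ∑ q ∈ deltaT j p, G q ≤ 4 * ∑ q ∈ Y, G q := by
  classical
  have h1 : ∀ j ∈ J, ∑ p ∈ S' j, ∑ q ∈ deltaT j p, G q =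
      ∑ q ∈ Y, (((S' j).filter fun p => q ∈ deltaT j p).card : ℝ) * G q := by
    intro j hj
    rw [Finset.sum_comm' (t' := Y) (s' := fun q => (S' j).filter fun p => q ∈ deltaT j p)]
    · refine Finset.sum_congr rfl fun q _ => ?_
      rw [Finset.sum_const, nsmul_eq_mul]
    · intro p q
      simp only [Finset.mem_filter]
      constructor
      · rintro ⟨hp, hq⟩
        exact ⟨⟨hp, hq⟩, hY j hj p hp hq⟩
      · rintro ⟨⟨hp, hq⟩, -⟩
        exact ⟨hp, hq⟩
  rw [Finset.sum_congr rfl h1, Finset.sum_comm, Finset.mul_sum]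
  refine Finset.sum_le_sum fun q hq => ?_
  rw [← Finset.sum_mul]
  have hcnt := card_filter_levels_le M₁ R Ω₀ S hR hdiv J hJ S' hS' hS q
  have hcnt' : (∑ j ∈ J, (((S' j).filter fun p => q ∈ deltaT j p).card : ℝ)) ≤ 4 := by exact_mod_cast hcnt
  exact mul_le_mul_of_nonneg_right hcnt' (hG q hq)

/-- **(71) FOR ALL LARGE-FIELD PLAQUETTES OF ALL SCALES SIMULTANEOUSLY, ON THE TORUS CARRIER OF RECORD, `c₁ = ¼`:** let the domains
`Ω_j` be generated by the p. 268 rule from the large-field plaquette sets `P_j = S j` made on the domains (`S j ⊆ plaqsIn j Ω_j`), with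
`R(g_i)M₁ ≥ 0`, `L ∣ M₁`, levels `j ∈ J` in the standing range; let the history's large-field plaquettes be `S′ j ⊆ S j`, the regions
`Δ′_j(p′) = deltaT j p′` lie in a finite set `Y` of fine plaquettes with `act ≥ 0` there, and suppose the per-plaquette (71)
`w(j, p′) ≤ c·Σ_{q∈Δ′_j(p′)} act(q)` (`c ≥ 0`; print: `w = ¼p²(g_j)`, `c = (1/g_k²)η⁻¹`).  THEN
**`¼·Σ_{j∈J} Σ_{p′∈S′ j} w(j, p′) ≤ c·Σ_{q∈Y} act(q)`** — «We get these small factors for all plaquettes in all large fields set P» with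
the overlap constant `c₁ = ¼` of `B10LargeFieldSum.SmallFactorsAll`, no reading hypothesis left. [cite: Balaban1985UV3, (71) p.273, (41) p.266, (38) p.266, p.268] -/
theorem quarter_sum_le_of_local71_torus (hR : ∀ i, 0 ≤ R i * M₁) (hdiv : P.L ∣ M₁) (J : Finset ℕ)
    (hJ : ∀ j ∈ J, j ≤ P.m + P.K) (S' : (j : ℕ) → Finset (Plaq P j)) (hS' : ∀ j ∈ J, S' j ⊆ S j)
    (hS : ∀ j ∈ J, S j ⊆ plaqsIn j (Ω M₁ R Ω₀ S j)) (Y : Finset (Plaq P 0))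
    (hY : ∀ j ∈ J, ∀ p ∈ S' j, deltaT j p ⊆ Y) (act : Plaq P 0 → ℝ) (hact : ∀ q ∈ Y, 0 ≤ act q)
    (w : (j : ℕ) → Plaq P j → ℝ) {c : ℝ} (hc : 0 ≤ c)
    (h71 : ∀ j ∈ J, ∀ p ∈ S' j, w j p ≤ c * ∑ q ∈ deltaT j p, act q) :
    (1 / 4 : ℝ) * ∑ j ∈ J, ∑ p ∈ S' j, w j p ≤ c * ∑ q ∈ Y, act q := by
  have hsum : ∑ j ∈ J, ∑ p ∈ S' j, w j p ≤ c * ∑ j ∈ J, ∑ p ∈ S' j, ∑ q ∈ deltaT j p, act q := by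
    rw [Finset.mul_sum]
    refine Finset.sum_le_sum fun j hj => ?_
    rw [Finset.mul_sum]
    exact Finset.sum_le_sum fun p hp => h71 j hj p hp
  have h4 := sum_sum_deltaT_le M₁ R Ω₀ S hR hdiv J hJ S' hS' hS Y hY act hact
  have h5 : c * ∑ j ∈ J, ∑ p ∈ S' j, ∑ q ∈ deltaT j p, act q ≤ c * (4 * ∑ q ∈ Y, act q) :=
    mul_le_mul_of_nonneg_left h4 hc
  linarith

/-- The printed weights (`w(j, p′) = ¼p(g_j)²`, `p = B10.pFun b₀ p₀`, along a coupling progression `g`):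
`¼·Σ_{j∈J} Σ_{p′∈S′ j} ¼p(g_j)² ≤ c·Σ_{q∈Y} act(q)` — literally `SmallFactorsAll`'s sum `c₁·Σ_{(j,p′)∈P} p(g_j)²/4` at `c₁ = ¼`.
[cite: Balaban1985UV3, (71) p.273, (41) p.266] -/
theorem smallFactorsAll_shape_torus (hR : ∀ i, 0 ≤ R i * M₁) (hdiv : P.L ∣ M₁) (J : Finset ℕ)
    (hJ : ∀ j ∈ J, j ≤ P.m + P.K) (S' : (j : ℕ) → Finset (Plaq P j)) (hS' : ∀ j ∈ J, S' j ⊆ S j)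
    (hS : ∀ j ∈ J, S j ⊆ plaqsIn j (Ω M₁ R Ω₀ S j)) (Y : Finset (Plaq P 0))
    (hY : ∀ j ∈ J, ∀ p ∈ S' j, deltaT j p ⊆ Y) (act : Plaq P 0 → ℝ) (hact : ∀ q ∈ Y, 0 ≤ act q)
    (b₀ p₀ : ℝ) (g : ℕ → ℝ) {c : ℝ} (hc : 0 ≤ c)
    (h71 : ∀ j ∈ J, ∀ p ∈ S' j, B10.pFun b₀ p₀ (g j) ^ 2 / 4 ≤ c * ∑ q ∈ deltaT j p, act q) :
    (1 / 4 : ℝ) * ∑ j ∈ J, ∑ _p ∈ S' j, B10.pFun b₀ p₀ (g j) ^ 2 / 4 ≤ c * ∑ q ∈ Y, act q :=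
  quarter_sum_le_of_local71_torus M₁ R Ω₀ S hR hdiv J hJ S' hS' hS Y hY act hact (fun j _ => B10.pFun b₀ p₀ (g j) ^ 2 / 4)
    hc h71

end Assembly

end Literature.MathematicalPhysics.QuantumFieldTheory.Balaban1983to89.B10Eq71TorusOverlap

end
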